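import Literature.Geometry.Kaehler.AnalyticSetSheetMeasure
import Literature.Geometry.Kaehler.HolomorphicChainRectifiableHolds
import Literature.Geometry.GeometricMeasureTheory.CurrentsConstancy
import Literature.Geometry.GeometricMeasureTheory.RectifiableNormalize
import Literature.Geometry.GeometricMeasureTheory.CurrentsNullSupport
import HarnessLib

/-!
# Rectifiable cycles carried by the regular locus of an analytic set

Layer `Literature/Geometry/Kaehler`; lane `lit-hodgefound`, programme «CHAIN COMPACTNESS», file F4b
(the local constancy of the multiplicity of a weak limit of holomorphic chains,
[Chirka1989, §16.1 Prop. 1], p. 207: "if `a ∈ reg A` … the multiplicity of `T` in a neighborhood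
of `a` … is integer valued, and … locally constant on `reg A`").

**The theorem** (`HolomorphicChain.exists_int_eq_mul_setIntegral_carrier`). Let `T` be a
holomorphic `p`-chain (`p = q + 1`) on an open subset `Ω` of a finite-dimensional complex inner
product space `V` (only its carrier `reg|T|` and its orientation `ξ_T` matter), `R ∈ 𝓡_{2p}(V)` a
rectifiable current (for the underlying real inner product space) and `U` an open set on which
`R` is a cycle (`∂R(φ) = 0` for all `φ` supported in `U`) with `spt R ∩ U ⊆ reg|T|`. Then every
point `b ∈ reg|T| ∩ U` has an open neighbourhood `O ⊆ U` on which
`R = a · [reg|T| ∩ O, 1, ξ_T]` for an INTEGER `a`: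
`R(ψ) = a ∫_{reg|T| ∩ O} ψ(ξ_T) d𝓗^{2p}` for all `ψ` supported in `O`; moreover `O` carries a test
form `ψ₀` with `∫_{reg|T| ∩ O} ψ₀(ξ_T) d𝓗^{2p} > 0` (so `a` is determined by `R`).

**Proof** (Federer's constancy theorem [Federer1969, 4.1.31 (2)] on a holomorphic sheet, by the
method of `Current.IsRectifiable.exists_int_restrictSet_eq_face`). Take the sheet neighbourhood
`reg|T| ∩ O = s(W)` of `b` over a ball `W` of the tangent plane `K` (`exists_sheet_nhds`), shrink
it to a tube `O'` over `W'' = B(ℓ b, δ/2)`, and write `R = [W_R, θ, ξ]`.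
1. Off `spt R` the density `θ` vanishes a.e. (`ae_eq_zero_of_mem_sdiff_support_vectorCurrent`),
   so on forms supported in `O'`, `R` is carried by `W₀ = W_R ∩ reg|T| ∩ O'`.
2. A.e. on `W₀` both `ξ` and `ξ_T` are orthonormal frames of the approximate tangent plane
   (`ae_span_eq_approxTangentCone_restrict_of_subset`), hence `ξ₁ ∧ ⋯ = ± ξ_T,₁ ∧ ⋯`
   (`frameVector_eq_or_eq_neg_of_span_eq`) and `θ ξ = η ξ_T` with an INTEGER density `η = ± θ`;
   `η` is the measurable function `x ↦ J(ℓ x) · (θ ξ)(ℓ^* e^*)`, `J = (normDet ∂s)²`, by the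
   Jacobian cancellation `e^*(ℓ ∘ ξ_T(s t)) J(t) = e^*(e) = 1`
   (`apply_orientationFrame_mul_normDet_sq_of_section`).
3. Testing `∂R = 0` on the forms `β (g ∘ ℓ) · ℓ^*(e ∘ i.succAbove)^*` (`β` a cut-off equal to `1`
   near the sheet, `g` a test function on the base) and transporting to the base by the area
   formula (`integral_image_sheet_eq`) shows that `η ∘ s` (w.r.t. `𝓗^{2p} ⌞ S₀`, `s(S₀) = W₀`) has
   zero distributional gradient on `W''`; by `ZeroGradient.exists_const` it is an a.e. constant
   `a`, an integer.
4. Transporting back, `R(ψ) = a ∫_{s(W'')} ψ(ξ_T) d𝓗^{2p}`; and for `ψ₀ = β (g ∘ ℓ) ℓ^* e^*` with a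
   bump `g ≥ 0`, `∫_{s(W'')} ψ₀(ξ_T) = ∫ g > 0`.

Also: `HolomorphicChain.ae_restrict_comp_sheet` (a.e. properties of the sheet pull back to a.e.
properties of the base). Theorems only; no new definitions, no named facts.

## References

* [Chirka1989] E. M. Chirka, *Complex Analytic Sets*, Kluwer 1989, §16.1 Prop. 1, p. 207.
* [Federer1969] H. Federer, *Geometric Measure Theory*, Springer 1969, 4.1.28, 4.1.31 (2), 3.2.5.
-/

noncomputable section

open scoped Manifold Topology ENNReal NNReal InnerProductSpace Distributions ContDiff
open Set Filter MeasureTheory Metric Module Function TopologicalSpace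

namespace Literature.Geometry.Kaehler

open Literature.Geometry.GeometricMeasureTheory

-- Nested operator-norm instances on (duals of) `V [⋀^Fin n]→L[ℝ] ℝ`.
set_option maxSynthPendingDepth 2

universe u

variable {V : Type u} [NormedAddCommGroup V] [InnerProductSpace ℂ V] [FiniteDimensional ℂ V]
  [MeasurableSpace V] [BorelSpace V] {Ω : Opens V} {q : ℕ}

/-! ### Two pieces of plumbing -/

/-- For `f` continuous on a measurable set `W`, the trace `W ∩ f⁻¹(A)` of the preimage of a
measurable set is measurable. [folklore] -/
private theorem measurableSet_inter_preimage_of_continuousOn {X Y : Type*} [TopologicalSpace X]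
    [MeasurableSpace X] [OpensMeasurableSpace X] [TopologicalSpace Y] [MeasurableSpace Y]
    [BorelSpace Y] {f : X → Y} {W : Set X} (hW : MeasurableSet W) (hf : ContinuousOn f W)
    {A : Set Y} (hA : MeasurableSet A) : MeasurableSet (W ∩ f ⁻¹' A) := by
  classical
  rcases isEmpty_or_nonempty Y with hY | ⟨⟨y₀⟩⟩
  · haveI : IsEmpty X := ⟨fun x => hY.elim (f x)⟩
    rw [Set.eq_empty_of_isEmpty (W ∩ f ⁻¹' A)]
    exact MeasurableSet.empty
  · have hm : Measurable (W.piecewise f fun _ => y₀) :=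
      hf.measurable_piecewise continuousOn_const hW
    have : W ∩ f ⁻¹' A = W ∩ (W.piecewise f fun _ => y₀) ⁻¹' A := by
      ext x
      simp only [mem_inter_iff, mem_preimage]
      constructor
      · rintro ⟨hx, h⟩; exact ⟨hx, by rwa [piecewise_eq_of_mem _ _ _ hx]⟩
      · rintro ⟨hx, h⟩; exact ⟨hx, by rwa [piecewise_eq_of_mem _ _ _ hx] at h⟩
    rw [this]
    exact hW.inter (hm hA)

/-- Pulling a constant covector and a linear form back along `A` commutes with the formation of
`alternatizeUncurryFin`: `alt((L ∘ A) ⊗ A^*c) = A^*(alt(L ⊗ c))`. [folklore] -/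
private theorem alternatizeUncurryFin_smulRight_compContinuousLinearMap {E₁ E₂ : Type*}
    [NormedAddCommGroup E₁] [NormedSpace ℝ E₁] [NormedAddCommGroup E₂] [NormedSpace ℝ E₂]
    {n : ℕ} (L : E₂ →L[ℝ] ℝ) (c : E₂ [⋀^Fin n]→L[ℝ] ℝ) (A : E₁ →L[ℝ] E₂) :
    ContinuousAlternatingMap.alternatizeUncurryFin
        ((L.comp A).smulRight (c.compContinuousLinearMap A)) =
      (ContinuousAlternatingMap.alternatizeUncurryFin (L.smulRight c)).compContinuousLinearMap A := by
  ext v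
  simp only [ContinuousAlternatingMap.alternatizeUncurryFin_apply,
    ContinuousAlternatingMap.compContinuousLinearMap_apply, ContinuousLinearMap.smulRight_apply,
    ContinuousLinearMap.comp_apply, ContinuousAlternatingMap.smul_apply, Function.comp_apply]
  rfl

namespace HolomorphicChain

/-! ### A.e. properties pull back along a sheet -/

section Transport

variable {K : Type*} [NormedAddCommGroup K] [InnerProductSpace ℂ K] [FiniteDimensional ℂ K]
  [MeasurableSpace K] [BorelSpace K]

/-- **A.e. properties of a sheet pull back to the base**: for an injective holomorphic immersion
`s` of the open `W ⊆ K` (`dim_ℂ K = p`) and measurable `S ⊆ W`, a property holding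
`𝓗^{2p} ⌞ s(S)`-a.e. holds at `s t` for `𝓗^{2p} ⌞ S`-a.e. `t` (null sets of the sheet have null
preimages, `measure_inter_preimage_eq_zero_of_sheet`). [cite: Federer1969, 3.2.3, 3.2.5] -/
theorem ae_restrict_comp_sheet {p : ℕ} (hK : finrank ℂ K = p) {s : K → V} {W : Set K}
    (hW : IsOpen W) (hs : DifferentiableOn ℂ s W) (hinj : InjOn s W)
    (himm : ∀ x ∈ W, Injective (fderiv ℂ s x)) {S : Set K} (hS : MeasurableSet S) (hSW : S ⊆ W)
    {P : V → Prop} (h : ∀ᵐ y ∂((μHE[2 * p] : Measure V).restrict (s '' S)), P y) :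
    ∀ᵐ t ∂((μHE[2 * p] : Measure K).restrict S), P (s t) := by
  have hSm : MeasurableSet (s '' S) :=
    hS.image_of_continuousOn_injOn (hs.continuousOn.mono hSW) (hinj.mono hSW)
  rw [ae_iff, Measure.restrict_apply' hSm] at h
  have h0 := measure_inter_preimage_eq_zero_of_sheet hK hW hs hinj himm hS hSW h
  rw [ae_iff, Measure.restrict_apply' hS]
  refine measure_mono_null (fun t ht => ?_) h0
  exact ⟨ht.2, ht.1, t, ht.2, rfl⟩

omit [FiniteDimensional ℂ V] [MeasurableSpace V] [BorelSpace V] [MeasurableSpace K]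
  [BorelSpace K] in
/-- The real Jacobian of a complex-linear injection is positive: `(normDet L)² > 0`. [folklore] -/
private theorem normDet_sq_pos' {L : K →ₗ[ℂ] V} (hL : Injective L) : 0 < L.normDet ^ 2 := by
  have h0 : L.normDet ≠ 0 := by
    rw [ne_eq, LinearMap.normDet_eq_zero_iff_ker_ne_bot, not_not]
    exact LinearMap.ker_eq_bot.2 hL
  positivity

omit [MeasurableSpace V] [BorelSpace V] [MeasurableSpace K] [BorelSpace K] in
/-- The Jacobian `t ↦ (normDet ∂s(t))²` of a holomorphic map is continuous on its open domain
(it is the real Jacobian `normDet (∂s(t))_ℝ` of the `C¹` map `s`). [folklore] -/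
private theorem continuousOn_normDet_sq' {s : K → V} {W : Set K} (hW : IsOpen W)
    (hs : DifferentiableOn ℂ s W) :
    ContinuousOn (fun t => (fderiv ℂ s t : K →ₗ[ℂ] V).normDet ^ 2) W := by
  letI : InnerProductSpace ℝ K := InnerProductSpace.complexToReal
  letI : InnerProductSpace ℝ V := InnerProductSpace.complexToReal
  have hC1 : ContDiffOn ℝ 1 s W :=
    ((Literature.Analysis.Complex.SCV.analyticOnNhd_of_differentiableOn hs hW).contDiffOn
      (n := 1) hW.uniqueDiffOn).restrict_scalars ℝ
  have hc : ContinuousOn (fun t => ((fderiv ℝ s t : K →L[ℝ] V) : K →ₗ[ℝ] V).normDet) W :=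
    Literature.Analysis.Calculus.continuous_normDet.comp_continuousOn
      (hC1.continuousOn_fderiv_of_isOpen hW le_rfl)
  refine hc.congr fun t ht => ?_
  have hd : DifferentiableAt ℂ s t := hs.differentiableAt (hW.mem_nhds ht)
  show (fderiv ℂ s t : K →ₗ[ℂ] V).normDet ^ 2 = ((fderiv ℝ s t : K →L[ℝ] V) : K →ₗ[ℝ] V).normDet
  rw [hd.fderiv_restrictScalars ℝ, ← normDet_restrictScalars_eq_normDet_sq]
  rfl

end Transport

/-! ### The constancy theorem on a sheet of the carrier -/

set_option maxHeartbeats 800000 in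
-- the assembled proof term is large: the final `whnf` bookkeeping exceeds the default budget
/-- **A rectifiable cycle carried by the regular locus of a holomorphic chain is, near each
regular point, an integer multiple of the current of integration.** Let `T` be a holomorphic
`p`-chain on `Ω` (`p = q + 1`), `R ∈ 𝓡_{2p}(V)` rectifiable, `U` open with `∂R(φ) = 0` for all
`(2p-1)`-forms `φ` supported in `U` and `spt R ∩ U ⊆ reg|T|`, and `b ∈ reg|T| ∩ U`. Then there are
an integer `a` and an open `O` with `b ∈ O ⊆ U` such that
`R(ψ) = a · ∫_{reg|T| ∩ O} ψ(ξ_T) d𝓗^{2p}` for every `2p`-form `ψ` supported in `O`, and a form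
`ψ₀` supported in `O` with `∫_{reg|T| ∩ O} ψ₀(ξ_T) d𝓗^{2p} > 0` (Federer's constancy theorem on the
sheet `reg|T| ∩ O`, a connected oriented `2p`-dimensional submanifold of class `∞`; "the
multiplicity … is integer valued and locally constant on `reg A`").
[cite: Federer1969, 4.1.31 (2); Chirka1989, §16.1 Prop. 1 (proof), p. 207] -/
theorem exists_int_eq_mul_setIntegral_carrier (T : HolomorphicChain 𝓘(ℂ, V) Ω (q + 1))
    {R : Current (⊤ : Opens V) (2 * (q + 1))}
    (hR : letI : InnerProductSpace ℝ V := InnerProductSpace.complexToReal; R.IsRectifiable)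
    {U : Set V} (hU : IsOpen U)
    (hbdry : ∀ φ : TestForm (⊤ : Opens V) (2 * q + 1), tsupport ⇑φ ⊆ U →
      Current.boundary (R : Current (⊤ : Opens V) (2 * q + 1 + 1)) φ = 0)
    (hsupp : R.support ∩ U ⊆ T.carrier) {b : V} (hb : b ∈ T.carrier) (hbU : b ∈ U) :
    ∃ (a : ℤ) (O : Set V), IsOpen O ∧ b ∈ O ∧ O ⊆ U ∧
      (∀ ψ : TestForm (⊤ : Opens V) (2 * (q + 1)), tsupport ⇑ψ ⊆ O →
        R ψ = (a : ℝ) * ∫ x in T.carrier ∩ O, ψ x (T.orientationFrame x)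
          ∂(μHE[2 * (q + 1)] : Measure V)) ∧
      ∃ ψ₀ : TestForm (⊤ : Opens V) (2 * (q + 1)), tsupport ⇑ψ₀ ⊆ O ∧
        0 < ∫ x in T.carrier ∩ O, ψ₀ x (T.orientationFrame x) ∂(μHE[2 * (q + 1)] : Measure V) := by
  letI : InnerProductSpace ℝ V := InnerProductSpace.complexToReal
  haveI : FiniteDimensional ℝ V := FiniteDimensional.complexToReal V
  /- ## The sheet at `b` -/
  obtain ⟨K, δ, r, s, O, hK, hδ, hr, hOo, hbO, hOU, hOb, hrΩ, hs, hℓs, hsO, hcO, hOeq⟩ :=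
    T.exists_sheet_nhds hb hU hbU
  letI : InnerProductSpace ℝ K := InnerProductSpace.complexToReal
  haveI : FiniteDimensional ℝ K := FiniteDimensional.complexToReal K
  set ℓ : V →L[ℂ] K := K.orthogonalProjectionOnto with hℓdef
  set ℓR : V →L[ℝ] K := ℓ.restrictScalars ℝ with hℓR
  have hℓR_apply : ∀ x, ℓR x = ℓ x := fun x => rfl
  set W' : Set K := ball (ℓ b) δ with hW'
  have hW'o : IsOpen W' := isOpen_ball
  have hinj : InjOn s W' := fun w₁ h₁ w₂ h₂ h => by rw [← hℓs w₁ h₁, ← hℓs w₂ h₂, h]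
  have himm : ∀ w ∈ W', Injective (fderiv ℂ s w) := fun w hw =>
    injective_fderiv_of_section ℓ hW'o hs hℓs hw
  have hsW' : s '' W' ⊆ T.carrier := by rw [← hcO]; exact inter_subset_left
  have hsb : s (ℓ b) = b := by
    have hb' : b ∈ s '' W' := by rw [← hcO]; exact ⟨hb, hbO⟩
    obtain ⟨w, hw, hwb⟩ := hb'
    rw [← hwb, hℓs w hw]
  -- the Jacobian of the sheet
  set J : K → ℝ := fun t => (fderiv ℂ s t : K →ₗ[ℂ] V).normDet ^ 2 with hJ
  have hJc : ContinuousOn J W' := continuousOn_normDet_sq' hW'o hs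
  have hJpos : ∀ t ∈ W', 0 < J t := fun t ht => normDet_sq_pos' (himm t ht)
  -- a unitary basis of `K` and its real frame
  have h2K : Module.finrank ℝ K = 2 * (q + 1) := by rw [finrank_real_of_complex, hK]
  obtain ⟨e⟩ : Nonempty (OrthonormalBasis (Fin (q + 1)) ℂ K) :=
    ⟨(stdOrthonormalBasis ℂ K).reindex (finCongr hK)⟩
  set ef : Fin (2 * (q + 1)) → K := complexFrame ⇑e with hef
  have hefon : Orthonormal ℝ ef := orthonormal_complexFrame e.orthonormal
  -- Jacobian cancellation on the sheet
  have hcancel : ∀ t ∈ W', ∀ Φ : K [⋀^Fin (2 * (q + 1))]→L[ℝ] ℝ,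
      Φ (fun i => ℓ (T.orientationFrame (s t) i)) * J t = Φ ef := fun t ht Φ =>
    T.apply_orientationFrame_mul_normDet_sq_of_section hK ℓ hW'o hs hℓs hsW' ht
      (hOo.mem_nhds (hsO t ht)) hcO.subset Φ e
  /- ## Shrinking: the ball `W''`, the tube `O'`, the cut-off `β` -/
  set δ' : ℝ := δ / 2 with hδ'
  have hδ'0 : 0 < δ' := half_pos hδ
  have hδ'δ : δ' < δ := half_lt_self hδ
  set W'' : Set K := ball (ℓ b) δ' with hW''
  set D : Set K := closedBall (ℓ b) δ' with hD
  have hW''D : W'' ⊆ D := ball_subset_closedBall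
  have hDW' : D ⊆ W' := closedBall_subset_ball hδ'δ
  have hW''W' : W'' ⊆ W' := hW''D.trans hDW'
  have hDc : IsCompact D := isCompact_closedBall _ _
  have hsDc : IsCompact (s '' D) := hDc.image_of_continuousOn (hs.continuousOn.mono hDW')
  have hsDsub : s '' D ⊆ ball b r := by
    rintro _ ⟨w, hw, rfl⟩
    exact hOb (hsO w (hDW' hw))
  obtain ⟨r', hr'r, hsDr'⟩ := exists_lt_subset_ball hsDc.isClosed hsDsub
  have hbD : b ∈ s '' D := ⟨ℓ b, mem_closedBall_self hδ'0.le, hsb⟩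
  have hr'0 : 0 < r' := by
    have := hsDr' hbD
    rwa [mem_ball, dist_self] at this
  let β : ContDiffBump b := ⟨r', (r' + r) / 2, hr'0, by linarith⟩
  have hβrOut : closedBall b β.rOut ⊆ ball b r :=
    closedBall_subset_ball (by show (r' + r) / 2 < r; linarith)
  have hβ1 : ∀ t ∈ D, (β : V → ℝ) =ᶠ[𝓝 (s t)] 1 := fun t ht =>
    β.eventuallyEq_one_of_mem_ball (hsDr' ⟨t, ht, rfl⟩)
  have hβ1' : ∀ t ∈ D, β (s t) = 1 := fun t ht =>
    β.one_of_mem_closedBall (ball_subset_closedBall (hsDr' ⟨t, ht, rfl⟩))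
  -- the tube `O' = B(b, r) ∩ ℓ⁻¹ W''`
  set O' : Set V := ball b r ∩ ℓ ⁻¹' W'' with hO'
  have hO'o : IsOpen O' := isOpen_ball.inter (isOpen_ball.preimage ℓ.continuous)
  have hbO' : b ∈ O' := ⟨mem_ball_self hr, by show ℓ b ∈ W''; exact mem_ball_self hδ'0⟩
  have hO'O : O' ⊆ O := by
    rw [hOeq]
    exact inter_subset_inter_right _ (preimage_mono hW''W')
  have hO'U : O' ⊆ U := hO'O.trans hOU
  have hcO' : T.carrier ∩ O' = s '' W'' := by
    apply Subset.antisymm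
    · rintro x ⟨hxc, hxO'⟩
      have hx : x ∈ s '' W' := by rw [← hcO]; exact ⟨hxc, hO'O hxO'⟩
      obtain ⟨w, hw, rfl⟩ := hx
      have hw'' : w ∈ W'' := by
        have := hxO'.2
        rwa [mem_preimage, hℓs w hw] at this
      exact ⟨w, hw'', rfl⟩
    · rintro _ ⟨w, hw, rfl⟩
      exact ⟨hsW' ⟨w, hW''W' hw, rfl⟩, hOb (hsO w (hW''W' hw)),
        by show ℓ (s w) ∈ W''; rw [hℓs w (hW''W' hw)]; exact hw⟩
  have hcO'm : MeasurableSet (T.carrier ∩ O') := T.measurableSet_carrier.inter hO'o.measurableSet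
  -- lifting base test functions to the tube: `G = β · (g ∘ ℓ)`
  have hlift : ∀ g : K → ℝ, ContDiff ℝ ∞ g → HasCompactSupport g → tsupport g ⊆ W'' →
      ContDiff ℝ ∞ (fun x => β x * g (ℓ x)) ∧ HasCompactSupport (fun x => β x * g (ℓ x)) ∧
        tsupport (fun x => β x * g (ℓ x)) ⊆ O' := by
    intro g hg hgc hgW
    refine ⟨β.contDiff.mul (hg.comp ℓR.contDiff), β.hasCompactSupport.mul_right, fun x hx => ⟨?_, ?_⟩⟩
    · have h1 : x ∈ tsupport (β : V → ℝ) := tsupport_mul_subset_left hx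
      rw [β.tsupport_eq] at h1
      exact hβrOut h1
    · have h1 : x ∈ tsupport (fun x => g (ℓ x)) := tsupport_mul_subset_right hx
      have h2 : tsupport (fun x => g (ℓ x)) ⊆ ℓ ⁻¹' tsupport g := by
        refine closure_minimal (fun y hy => ?_) ((isClosed_tsupport g).preimage ℓ.continuous)
        exact subset_tsupport _ hy
      exact hgW (h2 h1)
  have hsmul_supp : ∀ {k : ℕ} (c : Covector V k) (ψ : 𝓓((⊤ : Opens V), ℝ)),
      tsupport ⇑(smulCovectorCLM c ψ) ⊆ tsupport (ψ : V → ℝ) := fun c ψ => by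
    refine closure_mono fun x hx => ?_
    rw [mem_support] at hx ⊢
    intro h0
    exact hx (by rw [smulCovectorCLM_apply, h0, zero_smul])
  /- ## The data of `R` and the carried part `W₀` -/
  obtain ⟨⟨W, θ, ξ, hdata, rfl⟩, hcpt⟩ := hR
  set μH : Measure V := μHE[2 * (q + 1)] with hμH
  set F : V → Multivector V (2 * (q + 1)) := fun x => (θ x : ℝ) • frameVector (ξ x) with hFdef
  have hTdata := Harvey1977_isRectifiableData_toCurrent_holds V Ω (q + 1) T
  set W₀ : Set V := W ∩ (T.carrier ∩ O') with hW₀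
  have hW₀m : MeasurableSet W₀ := hdata.1.inter hcO'm
  have hW₀c : W₀ ⊆ T.carrier := fun x hx => hx.2.1
  have hW₀par : ∀ x ∈ W₀, ℓ x ∈ W'' ∧ s (ℓ x) = x := by
    intro x hx
    have hx' : x ∈ s '' W'' := by rw [← hcO']; exact hx.2
    obtain ⟨w, hw, rfl⟩ := hx'
    rw [hℓs w (hW''W' hw)]
    exact ⟨hw, rfl⟩
  set μ₀ : Measure V := μH.restrict W₀ with hμ₀
  -- `θ = 0` a.e. off the support of `R`
  have hθ0 : ∀ᵐ x ∂μH, x ∈ W →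
      x ∉ (currentOfIntegration W θ ξ : Current (⊤ : Opens V) (2 * (q + 1))).support → θ x = 0 := by
    rw [← ae_restrict_iff' hdata.1]
    have h1 := ae_eq_zero_of_mem_sdiff_support_vectorCurrent (Ω := (⊤ : Opens V))
      (m := 2 * (q + 1)) hdata.2.2.2.1
    filter_upwards [h1, hdata.2.2.2.2] with x hx hon hxs
    have h2 : (θ x : ℝ) • frameVector (ξ x) = 0 := hx ⟨trivial, hxs⟩
    rcases smul_eq_zero.1 h2 with h3 | h3
    · exact_mod_cast h3
    · exact absurd (congrArg norm h3)
        (by rw [norm_frameVector_eq_one hon.1, norm_zero]; exact one_ne_zero)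
  -- the orientation of `T` is orthonormal on the carrier; test forms are bounded
  have hξTon : ∀ x ∈ T.carrier, Orthonormal ℝ (T.orientationFrame x) := fun x hx => by
    obtain ⟨u, hu, -, hξ⟩ := T.exists_orientationFrame_eq_complexFrame_span hx
    rw [hξ]
    exact orthonormal_complexFrame hu
  have hev : ∀ x ∈ T.carrier, ∀ τx : Covector V (2 * (q + 1)),
      ‖τx (T.orientationFrame x)‖ ≤ ‖τx‖ := fun x hx τx => by
    have := (frameVector (T.orientationFrame x)).le_opNorm τx
    rwa [frameVector_apply, norm_frameVector_eq_one (hξTon x hx), one_mul] at this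
  have hbd : ∀ τ : TestForm (⊤ : Opens V) (2 * (q + 1)), ∃ C : ℝ, ∀ x, ‖τ x‖ ≤ C := fun τ => by
    obtain ⟨C, hC⟩ :=
      (map_continuous τ).norm.bddAbove_range_of_hasCompactSupport τ.hasCompactSupport.norm
    exact ⟨C, fun x => hC (mem_range_self x)⟩
  /- ## Alignment of the frames and the integer density `η` -/
  have hspanW : ∀ᵐ x ∂μ₀, ((Submodule.span ℝ (range (ξ x)) : Set V) =
      approxTangentCone (2 * (q + 1)) μ₀ x) :=
    ae_span_eq_approxTangentCone_restrict_of_subset hdata.2.2.1 hW₀m inter_subset_left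
      (hdata.2.2.2.2.mono fun x hx => hx.2)
  have hspanT : ∀ᵐ x ∂μ₀, ((Submodule.span ℝ (range (T.orientationFrame x)) : Set V) =
      approxTangentCone (2 * (q + 1)) μ₀ x) :=
    ae_span_eq_approxTangentCone_restrict_of_subset hTdata.2.2.1 hW₀m hW₀c
      (hTdata.2.2.2.2.mono fun x hx => hx.2)
  have hsign : ∀ᵐ x ∂μ₀, frameVector (ξ x) = frameVector (T.orientationFrame x) ∨
      frameVector (ξ x) = -frameVector (T.orientationFrame x) := by
    filter_upwards [hspanW, hspanT, ae_restrict_of_ae_restrict_of_subset inter_subset_left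
      hdata.2.2.2.2, ae_restrict_mem hW₀m] with x h1 h2 h3 hxW₀
    exact frameVector_eq_or_eq_neg_of_span_eq (hξTon x (hW₀c hxW₀)) h3.1
      (SetLike.coe_injective (h1.trans h2.symm))
  -- the covector `C = ℓ^* e^*` and the density `η = J(ℓ x) (θ ξ)(C)`
  set c₀ : Covector K (2 * (q + 1)) := frameCovector ef with hc₀
  have hc₀ef : c₀ ef = 1 := frameCovector_self hefon
  set C : Covector V (2 * (q + 1)) := c₀.compContinuousLinearMap ℓR with hC
  have hC_apply : ∀ v : Fin (2 * (q + 1)) → V, C v = c₀ (fun i => ℓ (v i)) := fun v => rfl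
  set η : V → ℝ := fun x => J (ℓ x) * F x C with hη
  have hFC : ∀ x, F x C = (θ x : ℝ) * frameVector (ξ x) C := fun x => rfl
  have hae : ∀ᵐ x ∂μ₀, F x = η x • frameVector (T.orientationFrame x) ∧ ∃ n : ℤ, η x = n := by
    filter_upwards [hsign, ae_restrict_mem hW₀m] with x hx hxW₀
    obtain ⟨ht, hsx⟩ := hW₀par x hxW₀
    have hcan : C (T.orientationFrame x) * J (ℓ x) = 1 := by
      have := hcancel (ℓ x) (hW''W' ht) c₀
      rw [hsx] at this
      rw [hC_apply, this, hc₀ef]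
    rcases hx with hx | hx
    · have hηx : η x = θ x := by
        show J (ℓ x) * F x C = θ x
        rw [hFC, hx, frameVector_apply]
        calc J (ℓ x) * ((θ x : ℝ) * C (T.orientationFrame x))
            = θ x * (C (T.orientationFrame x) * J (ℓ x)) := by ring
          _ = θ x := by rw [hcan, mul_one]
      refine ⟨?_, θ x, hηx⟩
      rw [hηx]
      show (θ x : ℝ) • frameVector (ξ x) = _
      rw [hx]
    · have hηx : η x = -(θ x : ℝ) := by
        show J (ℓ x) * F x C = -(θ x : ℝ)
        rw [hFC, hx]
        show J (ℓ x) * ((θ x : ℝ) * -(C (T.orientationFrame x))) = _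
        calc J (ℓ x) * ((θ x : ℝ) * -C (T.orientationFrame x))
            = -(θ x : ℝ) * (C (T.orientationFrame x) * J (ℓ x)) := by ring
          _ = -(θ x : ℝ) := by rw [hcan, mul_one]
      refine ⟨?_, -θ x, by rw [hηx, Int.cast_neg]⟩
      rw [hηx]
      show (θ x : ℝ) • frameVector (ξ x) = _
      rw [hx, smul_neg]
      exact (neg_smul _ _).symm
  /- ## `R` on forms supported in the tube -/
  have happly : ∀ τ : TestForm (⊤ : Opens V) (2 * (q + 1)), tsupport ⇑τ ⊆ O' →
      (currentOfIntegration W θ ξ : Current (⊤ : Opens V) (2 * (q + 1))) τ =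
        ∫ x in W₀, τ x (T.orientationFrame x) * η x ∂μH := by
    intro τ hτ
    rw [currentOfIntegration_apply hdata.2.2.2.1,
      setIntegral_eq_of_subset_of_ae_sdiff_eq_zero hdata.1.nullMeasurableSet
        (inter_subset_left : W₀ ⊆ W) ?_]
    · refine integral_congr_ae ?_
      filter_upwards [hae] with x hx
      have : (θ x : ℝ) * τ x (ξ x) = F x (τ x) := rfl
      rw [this, hx.1]
      show η x * τ x (T.orientationFrame x) = _
      rw [mul_comm]
    · filter_upwards [hθ0] with x hx hxmem
      by_cases hxO : x ∈ O'
      · have hxc : x ∉ T.carrier := fun h => hxmem.2 ⟨hxmem.1, h, hxO⟩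
        have hxs : x ∉ (currentOfIntegration W θ ξ : Current (⊤ : Opens V) (2 * (q + 1))).support :=
          fun h => hxc (hsupp ⟨h, hO'U hxO⟩)
        rw [hx hxmem.1 hxs, Int.cast_zero, zero_mul]
      · have hτx : τ x = 0 := image_eq_zero_of_notMem_tsupport fun h => hxO (hτ h)
        rw [hτx]
        simp
  /- ## Integrability of `η` -/
  have hmass : (currentOfIntegration W θ ξ : Current (⊤ : Opens V) (2 * (q + 1))).mass < ⊤ :=
    hdata.mass_lt_top_of_isCompact_support hcpt
  have hFint : Integrable F (μH.restrict W) := by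
    have hsm : AEStronglyMeasurable F (μH.restrict W) := by
      have := hdata.2.2.2.1.aestronglyMeasurable
      rwa [show (((⊤ : Opens V) : Set V)) = univ from rfl, Measure.restrict_univ] at this
    refine ⟨hsm, ?_⟩
    have h1 : ∫⁻ x, ‖F x‖ₑ ∂(μH.restrict W) = ∫⁻ x in W, ‖(θ x : ℝ)‖ₑ ∂μH := by
      refine lintegral_congr_ae ?_
      filter_upwards [hdata.2.2.2.2] with x hx
      rw [hFdef]
      simp only
      rw [enorm_smul, ← ofReal_norm (frameVector (ξ x)), norm_frameVector_eq_one hx.1,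
        ENNReal.ofReal_one, mul_one]
    rw [HasFiniteIntegral, h1]
    exact hdata.mass_lt_top_iff.1 hmass
  have hFint₀ : Integrable F μ₀ :=
    hFint.mono_measure (Measure.restrict_mono inter_subset_left le_rfl)
  have hFC_int : Integrable (fun x => F x C) μ₀ :=
    (ContinuousLinearMap.apply ℝ ℝ C).integrable_comp hFint₀
  -- bounds for the Jacobian on the compact ball `D`
  obtain ⟨t₁, ht₁D, ht₁⟩ := hDc.exists_isMaxOn ⟨ℓ b, mem_closedBall_self hδ'0.le⟩ (hJc.mono hDW')
  obtain ⟨t₀, ht₀D, ht₀⟩ := hDc.exists_isMinOn ⟨ℓ b, mem_closedBall_self hδ'0.le⟩ (hJc.mono hDW')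
  have hJle : ∀ t ∈ D, J t ≤ J t₁ := fun t ht => isMaxOn_iff.1 ht₁ t ht
  have hJge : ∀ t ∈ D, J t₀ ≤ J t := fun t ht => isMinOn_iff.1 ht₀ t ht
  have hm0 : 0 < J t₀ := hJpos t₀ (hDW' ht₀D)
  have hJℓ : AEStronglyMeasurable (fun x => J (ℓ x)) μ₀ := by
    have hc : ContinuousOn (fun x => J (ℓ x)) (ℓ ⁻¹' W') :=
      hJc.comp ℓ.continuous.continuousOn fun x hx => hx
    exact (hc.mono fun x hx => (hW''W' (hW₀par x hx).1 : ℓ x ∈ W')).aestronglyMeasurable hW₀m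
  have hηint : Integrable η μ₀ := by
    refine hFC_int.bdd_mul hJℓ (c := J t₁) ?_
    filter_upwards [ae_restrict_mem hW₀m] with x hx
    rw [Real.norm_of_nonneg (hJpos _ (hW''W' (hW₀par x hx).1)).le]
    exact hJle _ (hW''D (hW₀par x hx).1)
  /- ## The base: `ν = 𝓗^{2p}` on `K`, the set `S₀` with `s(S₀) = W₀`, the density `ηK` -/
  set ν : Measure K := μHE[2 * (q + 1)] with hν
  haveI hHaar : ν.IsAddHaarMeasure := by
    have := MeasureTheory.isAddHaarMeasure_euclideanHausdorffMeasure (E := K)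
    rwa [h2K] at this
  set S₀ : Set K := W'' ∩ s ⁻¹' W₀ with hS₀
  have hS₀m : MeasurableSet S₀ :=
    measurableSet_inter_preimage_of_continuousOn isOpen_ball.measurableSet
      (hs.continuousOn.mono hW''W') hW₀m
  have hS₀W'' : S₀ ⊆ W'' := inter_subset_left
  have hS₀W' : S₀ ⊆ W' := hS₀W''.trans hW''W'
  have hsS₀ : s '' S₀ = W₀ := by
    apply Subset.antisymm
    · rintro _ ⟨t, ht, rfl⟩
      exact ht.2
    · intro x hx
      obtain ⟨ht, hsx⟩ := hW₀par x hx
      exact ⟨ℓ x, ⟨ht, by rw [mem_preimage, hsx]; exact hx⟩, hsx⟩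
  set ηK : K → ℝ := fun t => η (s t) with hηK
  set μK : Measure K := ν.restrict S₀ with hμK
  -- transport of `R(τ)` to the base
  have htrans : ∀ τ : TestForm (⊤ : Opens V) (2 * (q + 1)), tsupport ⇑τ ⊆ O' →
      (currentOfIntegration W θ ξ : Current (⊤ : Opens V) (2 * (q + 1))) τ =
        ∫ t in S₀, τ (s t) (T.orientationFrame (s t)) * η (s t) * J t ∂ν := by
    intro τ hτ
    obtain ⟨Cτ, hCτ⟩ := hbd τ
    have hint : Integrable (fun x => τ x (T.orientationFrame x) * η x) μ₀ := by
      refine hηint.bdd_mul ?_ (c := Cτ) ?_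
      · exact (T.aestronglyMeasurable_apply_orientationFrame (map_continuous τ)).mono_measure
          (Measure.restrict_mono hW₀c le_rfl)
      · filter_upwards [ae_restrict_mem hW₀m] with x hx
        exact (hev x (hW₀c hx) (τ x)).trans (hCτ x)
    rw [happly τ hτ]
    have hint' : Integrable (fun x => τ x (T.orientationFrame x) * η x)
        (μH.restrict (s '' S₀)) := by rwa [hsS₀]
    have key := (integral_image_sheet_eq hK hW'o hs hinj himm hS₀m hS₀W' hint').2
    rw [hsS₀] at key
    exact key
  -- integrability of `ηK` for `μK` (the Jacobian is bounded below on `D ⊇ S₀`)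
  have hηKint : Integrable ηK μK := by
    have h1 : Integrable (fun t => η (s t) * J t) (ν.restrict S₀) := by
      have hηint' : Integrable η (μH.restrict (s '' S₀)) := by rwa [hsS₀]
      exact (integral_image_sheet_eq hK hW'o hs hinj himm hS₀m hS₀W' hηint').1
    have h2 : AEStronglyMeasurable ηK μK := by
      have hηm : AEStronglyMeasurable η (μH.restrict (s '' S₀)) := by
        rw [hsS₀]; exact hηint.1
      exact aestronglyMeasurable_comp_sheet hK hW'o hs hinj himm hS₀m hS₀W' hηm
    refine Integrable.mono' (h1.norm.const_mul (J t₀)⁻¹) h2 ?_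
    filter_upwards [ae_restrict_mem hS₀m] with t ht
    have hJt : J t₀ ≤ J t := hJge t (hW''D (hS₀W'' ht))
    have hnorm : ‖η (s t) * J t‖ = ‖η (s t)‖ * J t := by
      rw [norm_mul, Real.norm_of_nonneg (hJpos t (hS₀W' ht)).le]
    rw [hnorm]
    calc ‖ηK t‖ = (J t₀)⁻¹ * (‖η (s t)‖ * J t₀) := by
          rw [mul_comm ‖η (s t)‖ (J t₀), ← mul_assoc, inv_mul_cancel₀ hm0.ne', one_mul]
      _ ≤ (J t₀)⁻¹ * (‖η (s t)‖ * J t) := by gcongr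
  /- ## Zero tangential gradient on the base -/
  have hbasis : ∀ g : K → ℝ, ContDiff ℝ ∞ g → HasCompactSupport g → tsupport g ⊆ W'' →
      ∀ i : Fin (2 * q + 1 + 1), ∫ t, fderiv ℝ g t (ef i) * ηK t ∂μK = 0 := by
    intro g hg hgc hgW i
    obtain ⟨hGs, hGc, hGO'⟩ := hlift g hg hgc hgW
    set ψ : 𝓓((⊤ : Opens V), ℝ) := ⟨fun x => β x * g (ℓ x), hGs, hGc, by simp⟩ with hψdef
    have hψx : ∀ x, ψ x = β x * g (ℓ x) := fun x => rfl
    set cK : Covector K (2 * q + 1) := frameCovector (fun j => ef (i.succAbove j)) with hcK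
    set Cᵢ : Covector V (2 * q + 1) := cK.compContinuousLinearMap ℓR with hCᵢ
    set φ : TestForm (⊤ : Opens V) (2 * q + 1) := smulCovectorCLM Cᵢ ψ with hφ
    have hφO' : tsupport ⇑φ ⊆ O' := (hsmul_supp Cᵢ ψ).trans hGO'
    have h0 := hbdry φ (hφO'.trans hO'U)
    rw [Current.boundary_apply] at h0
    have h0' : (currentOfIntegration W θ ξ : Current (⊤ : Opens V) (2 * (q + 1)))
        (TestForm.extDerivCLM φ) = 0 := h0
    rw [htrans _ ((TestForm.tsupport_extDerivCLM_subset φ).trans hφO')] at h0'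
    -- the exterior derivative on the sheet
    have hpt : ∀ t ∈ S₀, TestForm.extDerivCLM φ (s t) (T.orientationFrame (s t)) * J t =
        (-1) ^ (i : ℕ) * fderiv ℝ g t (ef i) := by
      intro t ht
      have htW'' : t ∈ W'' := hS₀W'' ht
      have htW' : t ∈ W' := hW''W' htW''
      have hfd : fderiv ℝ (ψ : V → ℝ) (s t) = (fderiv ℝ g t).comp ℓR := by
        have hev' : (ψ : V → ℝ) =ᶠ[𝓝 (s t)] (g ∘ ⇑ℓR) :=
          (hβ1 t (hW''D htW'')).mono fun x hx => by
            show β x * g (ℓ x) = g (ℓ x)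
            rw [hx, Pi.one_apply, one_mul]
        rw [hev'.fderiv_eq, fderiv_comp (s t) ((hg.differentiable (by simp)).differentiableAt)
          ℓR.differentiableAt, ℓR.fderiv, hℓR_apply, hℓs t htW']
      rw [hφ, extDerivCLM_smulCovectorCLM_apply, hfd, hCᵢ,
        alternatizeUncurryFin_smulRight_compContinuousLinearMap,
        ContinuousAlternatingMap.compContinuousLinearMap_apply]
      have h1 := hcancel t htW'
        (ContinuousAlternatingMap.alternatizeUncurryFin ((fderiv ℝ g t).smulRight cK))
      have h1' : (ContinuousAlternatingMap.alternatizeUncurryFin ((fderiv ℝ g t).smulRight cK))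
          (⇑ℓR ∘ T.orientationFrame (s t)) * J t =
          (ContinuousAlternatingMap.alternatizeUncurryFin ((fderiv ℝ g t).smulRight cK)) ef := h1
      rw [h1']
      let gψ : 𝓓((⊤ : Opens K), ℝ) := ⟨g, hg, hgc, by simp⟩
      have h2 := extDerivCLM_smulCovectorCLM_frameCovector_apply (Ω := (⊤ : Opens K)) hefon i gψ t
      rw [extDerivCLM_smulCovectorCLM_apply] at h2
      exact h2
    have h3 : ∫ t in S₀, TestForm.extDerivCLM φ (s t) (T.orientationFrame (s t)) * η (s t) * J t ∂ν =
        (-1) ^ (i : ℕ) * ∫ t, fderiv ℝ g t (ef i) * ηK t ∂μK := by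
      rw [← integral_const_mul]
      refine setIntegral_congr_fun hS₀m fun t ht => ?_
      show _ = (-1) ^ (i : ℕ) * (fderiv ℝ g t (ef i) * η (s t))
      rw [mul_right_comm, hpt t ht, mul_assoc]
    rw [h3] at h0'
    rcases mul_eq_zero.1 h0' with h4 | h4
    · exact absurd h4 (pow_ne_zero _ (by norm_num))
    · exact h4
  have hintg : ∀ g : K → ℝ, ContDiff ℝ ∞ g → HasCompactSupport g → ∀ v : K,
      Integrable (fun t => fderiv ℝ g t v * ηK t) μK := by
    intro g hg hgc v
    obtain ⟨C', hC'⟩ := (hgc.fderiv ℝ).exists_bound_of_continuous (hg.continuous_fderiv (by simp))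
    refine Integrable.mono' (hηKint.norm.const_mul (C' * ‖v‖))
      ((((hg.continuous_fderiv (by simp)).clm_apply continuous_const).aestronglyMeasurable).mul
        hηKint.1) (Eventually.of_forall fun t => ?_)
    rw [norm_mul]
    refine mul_le_mul_of_nonneg_right ((ContinuousLinearMap.le_opNorm _ _).trans ?_) (norm_nonneg _)
    exact mul_le_mul_of_nonneg_right (hC' t) (norm_nonneg _)
  have hspanef : Submodule.span ℝ (range ef) = ⊤ := by
    apply Submodule.eq_top_of_finrank_eq
    rw [finrank_span_eq_card hefon.linearIndependent, Fintype.card_fin, h2K]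
  have H : ZeroGradient.Hyp μK ηK W'' := by
    intro g hg hgc hgW v
    have hv : v ∈ Submodule.span ℝ (range ef) := by rw [hspanef]; trivial
    induction hv using Submodule.span_induction with
    | mem v hv =>
      obtain ⟨i, rfl⟩ := hv
      exact hbasis g hg hgc hgW i
    | zero => simp
    | add v w _ _ ihv ihw =>
      simp_rw [map_add, add_mul]
      rw [integral_add (hintg g hg hgc v) (hintg g hg hgc w), ihv, ihw, add_zero]
    | smul r' v _ ih =>
      simp_rw [map_smul, smul_eq_mul, mul_assoc]
      rw [integral_const_mul, ih, mul_zero]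
  obtain ⟨c, hc⟩ := ZeroGradient.exists_const ν μK hηKint H isOpen_ball
    (convex_ball (ℓ b) δ').isPreconnected
  /- ## The constant is an integer -/
  have hintK : ∀ᵐ t ∂μK, ∃ n : ℤ, ηK t = n := by
    have h1 : ∀ᵐ x ∂(μH.restrict (s '' S₀)), ∃ n : ℤ, η x = n := by
      rw [hsS₀]
      exact hae.mono fun x hx => hx.2
    exact ae_restrict_comp_sheet hK hW'o hs hinj himm hS₀m hS₀W' h1
  set ρ : Measure K := ν.restrict W'' with hρ
  haveI : IsFiniteMeasure ρ :=
    ⟨by rw [hρ, Measure.restrict_apply_univ]; exact measure_ball_lt_top⟩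
  have hρS₀ : ρ.restrict S₀ = μK := by
    rw [hρ, hμK, Measure.restrict_restrict hS₀m, inter_eq_left.2 hS₀W'']
  have hηind : Integrable (S₀.indicator ηK) ρ := by
    rw [integrable_indicator_iff hS₀m, IntegrableOn, hρS₀]
    exact hηKint
  have hind : S₀.indicator ηK =ᵐ[ρ] fun _ => c := by
    refine ae_eq_of_forall_setIntegral_eq_of_sigmaFinite (fun A _ _ => hηind.integrableOn)
      (fun A _ _ => integrableOn_const (measure_ne_top ρ A)) fun A hA _ => ?_
    rw [setIntegral_const]
    have e1 : ∫ x in A, S₀.indicator ηK x ∂ρ = ∫ x in A ∩ W'', ηK x ∂μK := by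
      rw [hρ, Measure.restrict_restrict hA, setIntegral_indicator hS₀m, hμK,
        Measure.restrict_restrict (hA.inter isOpen_ball.measurableSet)]
    have e2 : ρ.real A • c = c * (ν (A ∩ W'')).toReal := by
      rw [measureReal_def, hρ, Measure.restrict_apply hA, smul_eq_mul, mul_comm]
    rw [e1, e2]
    exact hc (A ∩ W'') (hA.inter isOpen_ball.measurableSet) inter_subset_right
      ((measure_mono inter_subset_right).trans_lt measure_ball_lt_top).ne
  have hint_ae : ∀ᵐ t ∂ρ, ∃ n : ℤ, S₀.indicator ηK t = n := by
    have h1 : ∀ᵐ t ∂ρ, t ∈ S₀ → ∃ n : ℤ, ηK t = n := by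
      rw [← ae_restrict_iff' hS₀m, hρS₀]
      exact hintK
    filter_upwards [h1] with t ht
    by_cases htS : t ∈ S₀
    · rw [indicator_of_mem htS]; exact ht htS
    · exact ⟨0, by rw [indicator_of_notMem htS, Int.cast_zero]⟩
  obtain ⟨a, ha⟩ : ∃ a : ℤ, S₀.indicator ηK =ᵐ[ρ] fun _ => (a : ℝ) := by
    by_cases hρ0 : ρ = 0
    · refine ⟨0, ?_⟩
      rw [hρ0, Filter.EventuallyEq, ae_zero]
      exact Filter.eventually_bot
    · haveI : (ae ρ).NeBot := ae_neBot.2 hρ0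
      obtain ⟨x, hx1, n, hx2⟩ := (hind.and hint_ae).exists
      refine ⟨n, hind.trans (Eventually.of_forall fun y => ?_)⟩
      show c = (n : ℝ)
      exact hx1.symm.trans hx2
  /- ## Integration over the sheet `s(W'') = reg|T| ∩ O'` -/
  have hsheet : ∀ τ : TestForm (⊤ : Opens V) (2 * (q + 1)),
      ∫ x in T.carrier ∩ O', τ x (T.orientationFrame x) ∂μH =
        ∫ t in W'', τ (s t) (T.orientationFrame (s t)) * J t ∂ν := by
    intro τ
    obtain ⟨Cτ, hCτ⟩ := hbd τ
    have hfin : μH (T.carrier ∩ O') < ⊤ :=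
      (measure_mono (inter_subset_inter_right _
        (inter_subset_left.trans ball_subset_closedBall))).trans_lt
        (T.measure_carrier_inter_lt_top (isCompact_closedBall b r) hrΩ)
    have h1 : IntegrableOn (fun x => τ x (T.orientationFrame x)) O' (μH.restrict T.carrier) :=
      Measure.integrableOn_of_bounded (M := Cτ)
        (by rw [Measure.restrict_apply hO'o.measurableSet, inter_comm]; exact hfin.ne)
        (T.aestronglyMeasurable_apply_orientationFrame (map_continuous τ))
        (by
          rw [Measure.restrict_restrict hO'o.measurableSet]
          filter_upwards [ae_restrict_mem (hO'o.measurableSet.inter T.measurableSet_carrier)]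
            with x hx
          exact (hev x hx.2 (τ x)).trans (hCτ x))
    rw [IntegrableOn, Measure.restrict_restrict hO'o.measurableSet, inter_comm, hcO'] at h1
    have key := (integral_image_sheet_eq hK hW'o hs hinj himm isOpen_ball.measurableSet hW''W' h1).2
    rw [hcO']
    exact key
  /- ## Conclusion -/
  refine ⟨a, O', hO'o, hbO', hO'U, fun τ hτ => ?_, ?_⟩
  · rw [htrans τ hτ, hsheet τ]
    have e1 : ∫ t in S₀, τ (s t) (T.orientationFrame (s t)) * η (s t) * J t ∂ν =
        ∫ t in W'', S₀.indicator ηK t * (τ (s t) (T.orientationFrame (s t)) * J t) ∂ν := by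
      have : (fun t => S₀.indicator ηK t * (τ (s t) (T.orientationFrame (s t)) * J t)) =
          S₀.indicator (fun t => τ (s t) (T.orientationFrame (s t)) * η (s t) * J t) := by
        funext t
        by_cases ht : t ∈ S₀
        · rw [indicator_of_mem ht, indicator_of_mem ht]
          show η (s t) * _ = _
          ring
        · rw [indicator_of_notMem ht, indicator_of_notMem ht, zero_mul]
      rw [this, setIntegral_indicator hS₀m, inter_eq_right.2 hS₀W'']
    have e2 : ∫ t in W'', S₀.indicator ηK t * (τ (s t) (T.orientationFrame (s t)) * J t) ∂ν =
        ∫ t in W'', (a : ℝ) * (τ (s t) (T.orientationFrame (s t)) * J t) ∂ν := by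
      refine integral_congr_ae ?_
      filter_upwards [ha] with t ht
      rw [ht]
    rw [e1, e2, integral_const_mul]
  · -- a non-negative bump on the base, lifted to the tube
    let gb : ContDiffBump (ℓ b) := ⟨δ' / 4, δ' / 2, by positivity, by linarith⟩
    have hgbW : tsupport (gb : K → ℝ) ⊆ W'' := by
      rw [gb.tsupport_eq]
      exact closedBall_subset_ball (by show δ' / 2 < δ'; linarith)
    obtain ⟨hGs, hGc, hGO'⟩ := hlift gb gb.contDiff gb.hasCompactSupport hgbW
    let ψG : 𝓓((⊤ : Opens V), ℝ) := ⟨fun x => β x * gb (ℓ x), hGs, hGc, by simp⟩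
    have hψGx : ∀ x, ψG x = β x * gb (ℓ x) := fun x => rfl
    refine ⟨smulCovectorCLM C ψG, (hsmul_supp C ψG).trans hGO', ?_⟩
    rw [hsheet]
    have e1 : ∫ t in W'', smulCovectorCLM C ψG (s t) (T.orientationFrame (s t)) * J t ∂ν =
        ∫ t in W'', gb t ∂ν := by
      refine setIntegral_congr_fun isOpen_ball.measurableSet fun t ht => ?_
      have htW' : t ∈ W' := hW''W' ht
      rw [smulCovectorCLM_apply, ContinuousAlternatingMap.smul_apply, smul_eq_mul, hψGx,
        hβ1' t (hW''D ht), one_mul, hℓs t htW', mul_assoc, hC_apply, hcancel t htW' c₀, hc₀ef,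
        mul_one]
    rw [e1, setIntegral_eq_integral_of_forall_compl_eq_zero fun t ht =>
      image_eq_zero_of_notMem_tsupport fun h => ht (hgbW h)]
    exact gb.integral_pos

end HolomorphicChain

end Literature.Geometry.Kaehler

end
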